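import Literature.Probability.FitznerVanDerHofstad2017.NobleSimplifiedFormF3Assembly
import HarnessLib

/-!
# (D.21): the weighted `ℓ¹` bound `Σ_x ‖x‖₂² |R_Φ(x)| ≤ β_{ΔR,Φ}` of the extended simplified form — proof

[NoBLE17] = Fitzner–van der Hofstad, *Generalized approach to the non-backtracking lace expansion*,
PTRF 169 (2017), App. D Step 3, (D.15)–(D.21) (pp. 1113–1115).

`NobleSimplifiedFormF3Assembly.nobleSimplifiedFormF3At_of_assumptions₅` assembles the extended simplified
rewrite from Assumptions 4.1–4.3 with three NAMED ANALYTIC HYPOTHESES, among them (D.21)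
`hD21 : Summable (‖x‖₂² |R_Φ(x)|) ∧ Σ_x ‖x‖₂² |R_Φ(x)| ≤ β_{ΔR,Φ}(i)` on the constructed remainder
`noblePhiRem S` of `NobleKSpaceRewritePhi`.  This module PROVES the display (D.21), d-generically, by the
argument of [NoBLE17] App. D Step 3:

* `R_Φ = (Ξ_R^{(0)} − Ξ_R^{(1)}) + Ξ_{≥2} + Σ_ι R_{Φ,ι}` with (the module docstring of `NobleKSpaceRewritePhi`, (D.15)–(D.16))
  `R_{Φ,ι} = −μ_p c_p (Ξ^{ι}_{R,I}(x+e_ι) − μ_p Ξ^{−ι}_{R,II}(x)) + μ_p c_p (Ξ^{ι}_{≥1}(x+e_ι) − μ_p Ξ^{−ι}_{≥1}(x))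
   − μ_p (Ψ^ι ⋆ w_ι)(x) + μ_p (T_ι + Ψ^ι ⋆ T_ι)(x)`, `c_p = (1−μ_p²)⁻¹`, `w_ι` the seed (4.18) and
  `T_ι = Σ_{n≥1} (−1)ⁿ (Aⁿ w)_ι` the Neumann tail of (4.19);
* every piece is dominated pointwise by a non-negative MAJORANT built from the classes `Ξ^{[·]}`, `Ξ^{[·],ι}`
  of Assumption 4.3 and the scalar iteration `T_{n+1} = B ⋆ T_n` of (D.6)–(D.8) started at the seed majorant
  `W₀ := Σ_ι c (Ξ^{[abs],ι}(·+e_ι) + μ Ξ^{[abs],−ι})` ((D.17)–(D.19)), with the scalar constants `μ_p ≤ μ`,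
  `p ≤ μ̄`, `p/μ_p ≤ β_{μ̄/μ}` of Assumption 4.3 substituted inside the majorant (monotone, all terms ≥ 0);
* the bundled mass-and-displacement bounds `MomentBound` of `NobleWeightedConvolution` ((D.25)–(D.28):
  `Σ_x ‖x‖₂² (f⋆g)(x) ≤ W_f L_g + L_f W_g` for even `f`) give `Σ_x ‖x‖₂² m(x) ≤ W` with an explicit `W`,
  and `W` is IDENTICAL, as a rational function of the inputs, to the printed (D.21) with its two series
  `Σ_{n≥1} tⁿ`, `Σ_{n≥1} (n+1) tⁿ` summed in closed form: `BetaMap.betaRpDeltaCorr` below.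

## A notebook-versus-print divergence in `β_{ΔR,Φ}` (recorded, not silently repaired)

The generated table `BetaMap.betaRpDelta` (a verbatim transcription of the Mathematica notebook `General.nb`,
function `betaRpDelta`, lines 82–84) carries in its second line the factor
`(mu + mu*PsiToXi*XiAbs)/(1+mu)`, whereas the printed (D.20)–(D.21) — and the bookkeeping proved here — give
`(μ + μ̄ β_Ξ)` WITHOUT the division by `(1+μ)`: summing (D.20) over `n ≥ 1`,
`Σ_{n≥1} (n+1) (2dμ̄/(1−μ))^{n+1} β_{Ξ^ι}ⁿ (μ/μ̄ + β_Ξ)[β_{ΔΞ^ι,ι} + μβ_{ΔΞ^ι,0}]/(1+μ)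
 = (2d/(1−μ²)) · t (1/(1−t)² + 1/(1−t)) · (μ + μ̄β_Ξ) · [β_{ΔΞ^ι,ι} + μβ_{ΔΞ^ι,0}]`, `t = 2dμ̄β_{Ξ^ι}/(1−μ)`.
So the notebook constant is SMALLER than the printed one by
`(2d/(1−μ²)) t (1/(1−t)² + 1/(1−t)) (μ + μ β_{μ̄/μ} β_Ξ) (1 − 1/(1+μ)) [β_{ΔΞ^ι,ι} + μβ_{ΔΞ^ι,0}] ≥ 0`
(`betaRpDeltaCorr_sub_betaRpDelta`, a `ring` identity; non-conservative direction).  We therefore prove (D.21)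
against the printed constant `betaRpDeltaCorr` and provide `extraOfInputsCorr` (component `3` replaced, the other
four components definitionally those of `extraOfInputs`) together with the assembled
`nobleSimplifiedFormF3At_of_assumptions₆` / `…_percolation₆`, in which (D.21) is no longer a hypothesis.
`BetaMap.lean` (generated) is not modified.  No numeral enters; no dimension is fixed.
-/

noncomputable section

namespace Literature.Probability.FitznerVanDerHofstad2017

/-! ## Part A. The printed constant `β_{ΔR,Φ}` of (D.21) -/

namespace BetaMap

/-- **`β_{ΔR,Φ}` as printed in (D.21)** (the two `n`-series of (D.19)–(D.20) summed in closed form), i.e. the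
notebook's `betaRpDelta` with the second line's factor `(μ + μ̄β_Ξ)` NOT divided by `(1+μ)`; same fifteen
arguments as `betaRpDelta`. [cite: FitznerVanDerHofstad2016NoBLE, App. D (D.19)–(D.21) (pp. 1114–1115)] -/
def betaRpDeltaCorr (d mu PsiToXi muPiToXii XiAbs XiDeltaAbs XiDeltaR XiDeltageqTwoAbs XiIotaAbs XiIotaDeltaEiAbs
    XiIotaDeltaZeroAbs XiIotaDeltaEigeqOneAbs XiIotaDeltaZerogeqOneAbs XiIotaDeltaRI XiIotaDeltaRII : ℝ) : ℝ :=
  let tmp2 := (2*d*muPiToXii)/(1-mu)*XiIotaAbs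
  let firstLine := XiDeltaR + XiDeltageqTwoAbs
  let secondLine := (2*d*mu)/(1-mu)*tmp2/(1-tmp2)*PsiToXi*XiDeltaAbs*XiIotaAbs +
    (2*d)/(1-mu^2)*tmp2*(1/((1-tmp2)^2) + 1/(1-tmp2))*(mu+mu*PsiToXi*XiAbs)*(XiIotaDeltaEiAbs + mu*XiIotaDeltaZeroAbs)
  let thirdLine := (2*d*mu*PsiToXi)/(1-mu^2)*((1+mu)*XiDeltaAbs*XiIotaAbs + XiAbs*(XiIotaDeltaEiAbs + mu*XiIotaDeltaZeroAbs))
  let fourthLine := (2*d*mu)/(1-mu^2)*(XiIotaDeltaRI + mu*XiIotaDeltaRII + XiIotaDeltaEigeqOneAbs + mu*XiIotaDeltaZerogeqOneAbs)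
  firstLine + secondLine + thirdLine + fourthLine

/-- **Printed minus notebook `β_{ΔR,Φ}`** = the second-line term times `(1 − 1/(1+μ))`.
[cite: FitznerVanDerHofstad2016NoBLE, App. D (D.20)–(D.21) (p. 1115)] -/
theorem betaRpDeltaCorr_sub_betaRpDelta (d mu PsiToXi muPiToXii XiAbs XiDeltaAbs XiDeltaR XiDeltageqTwoAbs XiIotaAbs
    XiIotaDeltaEiAbs XiIotaDeltaZeroAbs XiIotaDeltaEigeqOneAbs XiIotaDeltaZerogeqOneAbs XiIotaDeltaRI XiIotaDeltaRII : ℝ) :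
    betaRpDeltaCorr d mu PsiToXi muPiToXii XiAbs XiDeltaAbs XiDeltaR XiDeltageqTwoAbs XiIotaAbs XiIotaDeltaEiAbs
        XiIotaDeltaZeroAbs XiIotaDeltaEigeqOneAbs XiIotaDeltaZerogeqOneAbs XiIotaDeltaRI XiIotaDeltaRII -
      betaRpDelta d mu PsiToXi muPiToXii XiAbs XiDeltaAbs XiDeltaR XiDeltageqTwoAbs XiIotaAbs XiIotaDeltaEiAbs
        XiIotaDeltaZeroAbs XiIotaDeltaEigeqOneAbs XiIotaDeltaZerogeqOneAbs XiIotaDeltaRI XiIotaDeltaRII =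
      (2*d)/(1-mu^2)*((2*d*muPiToXii)/(1-mu)*XiIotaAbs)*
        (1/((1-(2*d*muPiToXii)/(1-mu)*XiIotaAbs)^2) + 1/(1-(2*d*muPiToXii)/(1-mu)*XiIotaAbs))*
        (mu+mu*PsiToXi*XiAbs)*(1 - 1/(1+mu))*(XiIotaDeltaEiAbs + mu*XiIotaDeltaZeroAbs) := by
  simp only [betaRpDeltaCorr, betaRpDelta]
  ring

/-- The printed constant dominates the notebook's one on the admissible region (`0 ≤ μ < 1`, `t < 1`, inputs ≥ 0).
[cite: FitznerVanDerHofstad2016NoBLE, App. D (D.20)–(D.21) (p. 1115)] -/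
theorem betaRpDelta_le_betaRpDeltaCorr {d mu PsiToXi muPiToXii XiAbs XiDeltaAbs XiDeltaR XiDeltageqTwoAbs XiIotaAbs
    XiIotaDeltaEiAbs XiIotaDeltaZeroAbs XiIotaDeltaEigeqOneAbs XiIotaDeltaZerogeqOneAbs XiIotaDeltaRI XiIotaDeltaRII : ℝ}
    (hd : 0 ≤ d) (hmu0 : 0 ≤ mu) (hmu1 : mu < 1) (hq : 0 ≤ PsiToXi) (hX : 0 ≤ XiAbs) (hpb : 0 ≤ muPiToXii)
    (hβ : 0 ≤ XiIotaAbs) (ht1 : (2*d*muPiToXii)/(1-mu)*XiIotaAbs < 1) (hE : 0 ≤ XiIotaDeltaEiAbs)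
    (hZ : 0 ≤ XiIotaDeltaZeroAbs) :
    betaRpDelta d mu PsiToXi muPiToXii XiAbs XiDeltaAbs XiDeltaR XiDeltageqTwoAbs XiIotaAbs XiIotaDeltaEiAbs
        XiIotaDeltaZeroAbs XiIotaDeltaEigeqOneAbs XiIotaDeltaZerogeqOneAbs XiIotaDeltaRI XiIotaDeltaRII ≤
      betaRpDeltaCorr d mu PsiToXi muPiToXii XiAbs XiDeltaAbs XiDeltaR XiDeltageqTwoAbs XiIotaAbs XiIotaDeltaEiAbs
        XiIotaDeltaZeroAbs XiIotaDeltaEigeqOneAbs XiIotaDeltaZerogeqOneAbs XiIotaDeltaRI XiIotaDeltaRII := by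
  rw [← sub_nonneg, betaRpDeltaCorr_sub_betaRpDelta]
  have h1 : 0 < 1 - mu := by linarith
  have h2 : 0 < 1 - mu ^ 2 := by nlinarith
  have ht0 : 0 ≤ (2*d*muPiToXii)/(1-mu)*XiIotaAbs := by positivity
  have h3 : 0 < 1 - (2*d*muPiToXii)/(1-mu)*XiIotaAbs := by linarith
  have h4 : 0 ≤ 1 - 1/(1+mu) := by
    rw [sub_nonneg, div_le_one (by linarith)]; linarith
  have h5 : 0 ≤ mu + mu*PsiToXi*XiAbs := by positivity
  have h6 : 0 ≤ 1/((1-(2*d*muPiToXii)/(1-mu)*XiIotaAbs)^2) + 1/(1-(2*d*muPiToXii)/(1-mu)*XiIotaAbs) := by positivity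
  have h7 : 0 ≤ (2*d)/(1-mu^2) := by positivity
  have h8 : 0 ≤ XiIotaDeltaEiAbs + mu*XiIotaDeltaZeroAbs := by positivity
  exact mul_nonneg (mul_nonneg (mul_nonneg (mul_nonneg (mul_nonneg h7 ht0) h6) h5) h4) h8

/-- The five further constants with component `3` the PRINTED `β_{ΔR,Φ}` (`betaRpDeltaCorr`); components
`0,1,2,4` are those of `extraOfInputs`. [cite: FitznerVanDerHofstad2016NoBLE, App. D (D.2), (D.3), (D.13), (D.21), (D.29)] -/
def extraOfInputsCorr (d : ℝ) (i : Inputs) : Fin 5 → ℝ :=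
  ![extraOfInputs d i 0, extraOfInputs d i 1, extraOfInputs d i 2,
    betaRpDeltaCorr d (i.mu) (i.mubOverMu) (i.mub) (i.xiAbs) (i.xiDeltaAbs) (i.xiR0Delta + i.xiR1Delta)
      (i.xiOddTailDelta + i.xiEvenTailDelta) (i.xiIotaAbs) (i.xiIotaDeltaEi) (i.xiIotaDeltaZero)
      (i.xiIotaOddDeltaEi + i.xiIotaEvenTailDeltaEi) (i.xiIotaOddDeltaZero + i.xiIotaEvenTailDeltaZero)
      (i.xiIotaRI0DeltaEi) (i.xiIotaRII0DeltaZero),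
    extraOfInputs d i 4]

/-- [folklore] -/
@[simp] theorem extraOfInputsCorr_zero (d : ℝ) (i : Inputs) : extraOfInputsCorr d i 0 = extraOfInputs d i 0 := rfl
/-- [folklore] -/
@[simp] theorem extraOfInputsCorr_one (d : ℝ) (i : Inputs) : extraOfInputsCorr d i 1 = extraOfInputs d i 1 := rfl
/-- [folklore] -/
@[simp] theorem extraOfInputsCorr_two (d : ℝ) (i : Inputs) : extraOfInputsCorr d i 2 = extraOfInputs d i 2 := rfl
/-- [folklore] -/
@[simp] theorem extraOfInputsCorr_four (d : ℝ) (i : Inputs) : extraOfInputsCorr d i 4 = extraOfInputs d i 4 := rfl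
/-- Component `3` is the printed `β_{ΔR,Φ}`. [cite: FitznerVanDerHofstad2016NoBLE, App. D (D.21) (p. 1115)] -/
theorem extraOfInputsCorr_three (d : ℝ) (i : Inputs) : extraOfInputsCorr d i 3 =
    betaRpDeltaCorr d (i.mu) (i.mubOverMu) (i.mub) (i.xiAbs) (i.xiDeltaAbs) (i.xiR0Delta + i.xiR1Delta)
      (i.xiOddTailDelta + i.xiEvenTailDelta) (i.xiIotaAbs) (i.xiIotaDeltaEi) (i.xiIotaDeltaZero)
      (i.xiIotaOddDeltaEi + i.xiIotaEvenTailDeltaEi) (i.xiIotaOddDeltaZero + i.xiIotaEvenTailDeltaZero)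
      (i.xiIotaRI0DeltaEi) (i.xiIotaRII0DeltaZero) := rfl

/-- Printed minus notebook, component `3`. [cite: FitznerVanDerHofstad2016NoBLE, App. D (D.21) (p. 1115)] -/
theorem extraOfInputsCorr_three_sub (d : ℝ) (i : Inputs) : extraOfInputsCorr d i 3 - extraOfInputs d i 3 =
    (2*d)/(1-i.mu^2)*((2*d*i.mub)/(1-i.mu)*i.xiIotaAbs)*
      (1/((1-(2*d*i.mub)/(1-i.mu)*i.xiIotaAbs)^2) + 1/(1-(2*d*i.mub)/(1-i.mu)*i.xiIotaAbs))*
      (i.mu+i.mu*i.mubOverMu*i.xiAbs)*(1 - 1/(1+i.mu))*(i.xiIotaDeltaEi + i.mu*i.xiIotaDeltaZero) :=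
  betaRpDeltaCorr_sub_betaRpDelta ..

end BetaMap

open _root_.MeasureTheory _root_.Filter _root_.Topology Finset
open scoped BigOperators
open Literature.Probability.LatticeModels
open Literature.Probability.Percolation
open Literature.Barriers.CriticalPhenomena
open Literature.Probability.RandomPlanarGeometry.SAW.Zd (normSq normSq_nonneg)

variable {d : ℕ}

/-! ## Part B. Pointwise class dominations and the weighted tails of Assumption 4.3 -/

section Classes

local notation "𝐞" => Literature.Probability.Percolation.stepVec

variable {p : unitInterval} {i : BetaMap.Inputs} {S : NobleSplit d p}

/-- `|Ξ^ι(y)| ≤ Ξ^{[abs],ι}(y)` (alternating series vs. series of absolute values). [cite: FitznerVanDerHofstad2016NoBLE, App. D (D.17), (D.24) (pp. 1114–1115)] -/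
theorem abs_nobleXiIota_le (h43 : NobleAssumption43At d p S i) (ι : Fin d × Bool) (y : Site d) :
    |nobleXiIota d p ι y| ≤ nobleXiIotaCls d p (fun N => N) (𝐞 ι) y := by
  have hs := (l1_of_NSumLE (fun N x => nobleXiIotaN_nonneg p _ N x) (h43.xiIotaAbs ι)).1 y
  unfold nobleXiIota nobleXiIotaCls
  exact abs_alternating_tsum_le hs fun N => nobleXiIotaN_nonneg p _ N y

/-- `|Ξ^ι_{≥1}(y)| ≤ Ξ^{[≥1],ι}(y)`. [cite: FitznerVanDerHofstad2016NoBLE, App. D (D.15), (D.21) (pp. 1113–1115)] -/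
theorem abs_nobleXiIotaTail_le (h43 : NobleAssumption43At d p S i) (ι : Fin d × Bool) (y : Site d) :
    |nobleXiIotaTail d p ι y| ≤ nobleXiIotaCls d p (fun N => N + 1) (𝐞 ι) y := by
  have hs := (l1_of_NSumLE (fun N x => nobleXiIotaN_nonneg p _ _ x) (NSumLE_nobleXiIotaN_tail h43 ι)).1 y
  unfold nobleXiIotaTail nobleXiIotaCls
  exact abs_alternating_tsum_le hs fun N => nobleXiIotaN_nonneg p _ _ y

/-- `|Ξ_{≥2}(y)| ≤ Ξ^{[≥2]}(y)`. [cite: FitznerVanDerHofstad2016NoBLE, App. D (D.15), (D.21) (pp. 1113–1115)] -/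
theorem abs_nobleXiTail_le (h43 : NobleAssumption43At d p S i) (y : Site d) :
    |nobleXiTail d p y| ≤ nobleXiCls d p (fun N => N + 2) y := by
  have hs := (l1_of_NSumLE (fun N x => nobleXiN_nonneg p _ x) (NSumLE_nobleXiN_tail h43)).1 y
  unfold nobleXiTail nobleXiCls
  exact abs_alternating_tsum_le hs fun N => nobleXiN_nonneg p _ y

/-- `Σ_N Σ_x ‖x‖₂² Ξ^{(N+2)}(x) ≤ β_{ΔΞ,even≥2} + β_{ΔΞ,odd≥3}`. [cite: FitznerVanDerHofstad2016NoBLE, Assumption 4.3 (4.49) (p. 1088); App. D (D.21) first line] -/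
theorem NSumLE_nobleXiN_tail_delta (h43 : NobleAssumption43At d p S i) :
    NSumLE (fun N x => euclidNorm x ^ 2 * nobleXiN d p (N + 2) x) (i.xiEvenTailDelta + i.xiOddTailDelta) := by
  refine NSumLE_of_even_odd (F := fun N x => euclidNorm x ^ 2 * nobleXiN d p (N + 2) x) ?_ ?_
  · have : (fun N x => euclidNorm x ^ 2 * nobleXiN d p (2 * N + 2) x) =
        fun N x => (fun N x => euclidNorm x ^ 2 * nobleXiN d p (N + 2) x) (2 * N) x := by
      funext N x; rfl
    simpa only using h43.xiEvenTailDelta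
  · have : (fun N x => (fun N x => euclidNorm x ^ 2 * nobleXiN d p (N + 2) x) (2 * N + 1) x) =
        fun N x => euclidNorm x ^ 2 * nobleXiN d p (2 * N + 3) x := by
      funext N x; simp only [show 2 * N + 1 + 2 = 2 * N + 3 by ring]
    rw [this]
    exact h43.xiOddTailDelta

/-- `Σ_N Σ_x ‖x−e_ι‖₂² Ξ^{(N+1),ι}(x) ≤ β_{ΔΞ^ι,odd,ι} + β_{ΔΞ^ι,even≥2,ι}`. [cite: FitznerVanDerHofstad2016NoBLE, Assumption 4.3 (4.33), (4.49) (pp. 1086–1088); App. D (D.21) last line] -/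
theorem NSumLE_nobleXiIotaN_tail_deltaEi (h43 : NobleAssumption43At d p S i) (ι : Fin d × Bool) :
    NSumLE (fun N x => euclidNorm (x - 𝐞 ι) ^ 2 * nobleXiIotaN d p (𝐞 ι) (N + 1) x)
      (i.xiIotaOddDeltaEi + i.xiIotaEvenTailDeltaEi) := by
  refine NSumLE_of_even_odd (F := fun N x => euclidNorm (x - 𝐞 ι) ^ 2 * nobleXiIotaN d p (𝐞 ι) (N + 1) x) ?_ ?_
  · exact h43.xiIotaOddDeltaEi ι
  · have : (fun N x => (fun N x => euclidNorm (x - 𝐞 ι) ^ 2 * nobleXiIotaN d p (𝐞 ι) (N + 1) x) (2 * N + 1) x) =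
        fun N x => euclidNorm (x - 𝐞 ι) ^ 2 * nobleXiIotaN d p (𝐞 ι) (2 * N + 2) x := by
      funext N x; simp only [show 2 * N + 1 + 1 = 2 * N + 2 by ring]
    rw [this]
    exact h43.xiIotaEvenTailDeltaEi ι

/-- `Σ_N Σ_x ‖x‖₂² Ξ^{(N+1),ι}(x) ≤ β_{ΔΞ^ι,odd,0} + β_{ΔΞ^ι,even≥2,0}`. [cite: FitznerVanDerHofstad2016NoBLE, Assumption 4.3 (4.32), (4.49) (pp. 1086–1088); App. D (D.21) last line] -/
theorem NSumLE_nobleXiIotaN_tail_deltaZero (h43 : NobleAssumption43At d p S i) (ι : Fin d × Bool) :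
    NSumLE (fun N x => euclidNorm x ^ 2 * nobleXiIotaN d p (𝐞 ι) (N + 1) x)
      (i.xiIotaOddDeltaZero + i.xiIotaEvenTailDeltaZero) := by
  refine NSumLE_of_even_odd (F := fun N x => euclidNorm x ^ 2 * nobleXiIotaN d p (𝐞 ι) (N + 1) x) ?_ ?_
  · exact h43.xiIotaOddDeltaZero ι
  · have : (fun N x => (fun N x => euclidNorm x ^ 2 * nobleXiIotaN d p (𝐞 ι) (N + 1) x) (2 * N + 1) x) =
        fun N x => euclidNorm x ^ 2 * nobleXiIotaN d p (𝐞 ι) (2 * N + 2) x := by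
      funext N x; simp only [show 2 * N + 1 + 1 = 2 * N + 2 by ring]
    rw [this]
    exact h43.xiIotaEvenTailDeltaZero ι

/-- `Ξ^{[≥2]}`: mass `≤ β_{Ξ,even≥2} + β_{Ξ,odd≥3}`, displacement `≤ β_{ΔΞ,even≥2} + β_{ΔΞ,odd≥3}`. [cite: FitznerVanDerHofstad2016NoBLE, Assumption 4.3 (4.49) (p. 1088); App. D (D.21) first line] -/
theorem momentBound_xiCls_tail2 (h43 : NobleAssumption43At d p S i) :
    MomentBound (nobleXiCls d p fun N => N + 2) (i.xiEvenTail + i.xiOddTail) (i.xiEvenTailDelta + i.xiOddTailDelta) :=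
  momentBound_of_NSumLE (fun _ x => nobleXiN_nonneg p _ x) (NSumLE_nobleXiN_tail h43) (NSumLE_nobleXiN_tail_delta h43)

/-- `Ξ^{[≥1],ι}(· + e_ι)` about `e_ι`. [cite: FitznerVanDerHofstad2016NoBLE, Assumption 4.3 (4.33), (4.49) (pp. 1086–1088); App. D (D.21) last line] -/
theorem momentBound_xiIotaCls_tail1_shift (h43 : NobleAssumption43At d p S i) (ι : Fin d × Bool) :
    MomentBound (fun x => nobleXiIotaCls d p (fun N => N + 1) (𝐞 ι) (x + 𝐞 ι)) (i.xiIotaOdd + i.xiIotaEvenTail)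
      (i.xiIotaOddDeltaEi + i.xiIotaEvenTailDeltaEi) :=
  momentBound_of_NSumLE_shift (fun _ x => nobleXiIotaN_nonneg p _ _ x) (NSumLE_nobleXiIotaN_tail h43 ι) (𝐞 ι)
    (NSumLE_nobleXiIotaN_tail_deltaEi h43 ι)

/-- `Ξ^{[≥1],ι}` about `0`. [cite: FitznerVanDerHofstad2016NoBLE, Assumption 4.3 (4.32), (4.49) (pp. 1086–1088); App. D (D.21) last line] -/
theorem momentBound_xiIotaCls_tail1 (h43 : NobleAssumption43At d p S i) (ι : Fin d × Bool) :
    MomentBound (nobleXiIotaCls d p (fun N => N + 1) (𝐞 ι)) (i.xiIotaOdd + i.xiIotaEvenTail)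
      (i.xiIotaOddDeltaZero + i.xiIotaEvenTailDeltaZero) :=
  momentBound_of_NSumLE (fun _ x => nobleXiIotaN_nonneg p _ _ x) (NSumLE_nobleXiIotaN_tail h43 ι)
    (NSumLE_nobleXiIotaN_tail_deltaZero h43 ι)

/-- `Σ_n t^{n+1} a_0 = a_0 t/(1−t)`. [folklore] -/
theorem tsum_pow_add_one_mul {t : ℝ} (ht0 : 0 ≤ t) (ht1 : t < 1) (a0 : ℝ) :
    (Summable fun n : ℕ => t ^ (n + 1) * a0) ∧ ∑' n : ℕ, t ^ (n + 1) * a0 = a0 * (t / (1 - t)) := by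
  have hg := summable_geometric_of_lt_one ht0 ht1
  have e : (fun n : ℕ => t ^ (n + 1) * a0) = fun n => t ^ n * (t * a0) := by
    funext n; ring
  rw [e]
  refine ⟨hg.mul_right _, ?_⟩
  rw [tsum_mul_right, tsum_geometric_of_lt_one ht0 ht1]
  have h1 : (1 - t) ≠ 0 := by linarith
  field_simp

/-- `Σ_n [(n+1) tⁿ c + t^{n+1} w_0] = c/(1−t)² + w_0 t/(1−t)`. [folklore] -/
theorem tsum_titerW_tail1 {t : ℝ} (ht0 : 0 ≤ t) (ht1 : t < 1) (c w0 : ℝ) :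
    (Summable fun n : ℕ => ((n : ℝ) + 1) * t ^ n * c + t ^ (n + 1) * w0) ∧
      ∑' n : ℕ, (((n : ℝ) + 1) * t ^ n * c + t ^ (n + 1) * w0) = c * (1 / (1 - t) ^ 2) + w0 * (t / (1 - t)) := by
  have htn : ‖t‖ < 1 := by rw [Real.norm_eq_abs, abs_of_nonneg ht0]; exact ht1
  have hg := summable_geometric_of_lt_one ht0 ht1
  have hng : Summable fun n : ℕ => (n : ℝ) * t ^ n := by
    simpa using summable_pow_mul_geometric_of_norm_lt_one 1 htn
  have e : (fun n : ℕ => ((n : ℝ) + 1) * t ^ n * c + t ^ (n + 1) * w0) =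
      fun n : ℕ => (n : ℝ) * t ^ n * c + t ^ n * (c + t * w0) := by
    funext n; ring
  rw [e]
  refine ⟨(hng.mul_right _).add (hg.mul_right _), ?_⟩
  rw [(hng.mul_right _).tsum_add (hg.mul_right _), tsum_mul_right, tsum_mul_right,
    tsum_coe_mul_geometric_of_norm_lt_one htn, tsum_geometric_of_lt_one ht0 ht1]
  have h1 : (1 - t) ≠ 0 := by linarith
  field_simp
  ring

/-- **The tail `Σ_{n≥1} T_n`** of the majorant iteration: mass `≤ a_0 t/(1−t)`, displacement
`≤ W_B a_0/(1−t)² + w_0 t/(1−t)` — the two `n`-series of (D.19)–(D.20). [cite: FitznerVanDerHofstad2016NoBLE, App. D (D.19)–(D.21) (pp. 1114–1115)] -/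
theorem momentBound_titer_tail1 {B t0 : Site d → ℝ} {t WB a0 w0 : ℝ} (hB : MomentBound B t WB)
    (hBe : ∀ x, B (-x) = B x) (h0 : MomentBound t0 a0 w0) (ht1 : t < 1) :
    MomentBound (fun x => ∑' n, titer B t0 (n + 1) x) (a0 * (t / (1 - t)))
      (WB * a0 * (1 / (1 - t) ^ 2) + w0 * (t / (1 - t))) := by
  have ht0 : 0 ≤ t := hB.L_nonneg
  have hn : ∀ n, MomentBound (titer B t0 (n + 1)) (t ^ (n + 1) * a0)
      (((n : ℝ) + 1) * t ^ n * (WB * a0) + t ^ (n + 1) * w0) := fun n => by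
    have h := momentBound_titer hB hBe h0 (n + 1)
    rw [titerW_succ_eq] at h
    exact h
  obtain ⟨hsL, heL⟩ := tsum_pow_add_one_mul ht0 ht1 a0
  obtain ⟨hsW, heW⟩ := tsum_titerW_tail1 ht0 ht1 (WB * a0) w0
  have h := MomentBound.tsum hn hsL hsW
  rw [heL, heW] at h
  exact h

end Classes

/-! ## Part C. The majorant of `|R_Φ|` ([NoBLE17] App. D Step 3, (D.17)–(D.21)) -/

section Majorant

local notation "𝐞" => Literature.Probability.Percolation.stepVec

variable {p : unitInterval} {P X : ℝ} {i : BetaMap.Inputs} {S : NobleSplit d p}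

/-- `W₀,ι(y) := (1−μ²)⁻¹ (Ξ^{[abs],ι}(y+e_ι) + μ Ξ^{[abs],−ι}(y)) ≥ |w_ι(y)|` — the seed majorant of (D.17)
(`b_ι = μ̄ W₀,ι`). [cite: FitznerVanDerHofstad2016NoBLE, App. D (D.17) (p. 1114)] -/
def nobleMajW0Dir (d : ℕ) (p : unitInterval) (i : BetaMap.Inputs) (ι : Fin d × Bool) (y : Site d) : ℝ :=
  (1 - i.mu ^ 2)⁻¹ * (nobleXiIotaCls d p (fun N => N) (𝐞 ι) (y + 𝐞 ι) + i.mu * nobleXiIotaCls d p (fun N => N) (𝐞 (srev ι)) y)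

/-- `W₀ := Σ_ι W₀,ι` — the start of the scalar iteration dominating `Σ_ι |(Aⁿ w)_ι|` ((D.18)).
[cite: FitznerVanDerHofstad2016NoBLE, App. D (D.17)–(D.18) (p. 1114)] -/
def nobleMajW0 (d : ℕ) (p : unitInterval) (i : BetaMap.Inputs) : Site d → ℝ :=
  fun y => ∑ ι : Fin d × Bool, nobleMajW0Dir d p i ι y

/-- `τ₁(x) := Σ_n T_{n+1}(x)`, `T_0 = W₀`, `T_{n+1} = B ⋆ T_n`, dominating `Σ_ι Σ_{n≥1} |(Aⁿ w)_ι(x)|` ((D.18)–(D.19)).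
[cite: FitznerVanDerHofstad2016NoBLE, App. D (D.18)–(D.20) (pp. 1114–1115)] -/
def nobleMajTau1 (d : ℕ) (p : unitInterval) (i : BetaMap.Inputs) (x : Site d) : ℝ :=
  ∑' n, titer (nobleMajB d p i) (nobleMajW0 d p i) (n + 1) x

/-- Majorant of `Σ_ι μ_p (T_ι + Ψ^ι ⋆ T_ι)`: `μ τ₁ + μ β_{μ̄/μ} (Ξ^{[abs]} ⋆ τ₁)` ((D.21) second line).
[cite: FitznerVanDerHofstad2016NoBLE, App. D (D.19)–(D.21) (pp. 1114–1115)] -/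
def nobleMajPhiM4 (d : ℕ) (p : unitInterval) (i : BetaMap.Inputs) (x : Site d) : ℝ :=
  i.mu * nobleMajTau1 d p i x + i.mu * i.mubOverMu * lconv (nobleXiCls d p fun N => N) (nobleMajTau1 d p i) x

/-- Majorant of the `Ξ^ι_R`-piece (direction `ι`): `μ (1−μ²)⁻¹ (Ξ^{(0),ι}_{R,I}(x+e_ι) + μ Ξ^{(0),−ι}_{R,II}(x))` ((D.21) last line).
[cite: FitznerVanDerHofstad2016NoBLE, Assumption 4.3 (4.46)–(4.47) (p. 1087); App. D (D.16), (D.21) (pp. 1113–1115)] -/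
def nobleMajPhiM1 (S : NobleSplit d p) (i : BetaMap.Inputs) (ι : Fin d × Bool) (x : Site d) : ℝ :=
  i.mu * (1 - i.mu ^ 2)⁻¹ * (S.xiIotaRI ι (x + 𝐞 ι) + i.mu * S.xiIotaRII (srev ι) x)

/-- Majorant of the `Ξ^ι_{≥1}`-piece (direction `ι`): `μ (1−μ²)⁻¹ (Ξ^{[≥1],ι}(x+e_ι) + μ Ξ^{[≥1],−ι}(x))` ((D.21) last line).
[cite: FitznerVanDerHofstad2016NoBLE, App. D (D.15), (D.21) (pp. 1113–1115)] -/
def nobleMajPhiM2 (d : ℕ) (p : unitInterval) (i : BetaMap.Inputs) (ι : Fin d × Bool) (x : Site d) : ℝ :=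
  i.mu * (1 - i.mu ^ 2)⁻¹ *
    (nobleXiIotaCls d p (fun N => N + 1) (𝐞 ι) (x + 𝐞 ι) + i.mu * nobleXiIotaCls d p (fun N => N + 1) (𝐞 (srev ι)) x)

/-- Majorant of `μ_p (Ψ^ι ⋆ w_ι)` (direction `ι`): `μ β_{μ̄/μ} (Ξ^{[abs]} ⋆ W₀,ι)` ((D.21) third line).
[cite: FitznerVanDerHofstad2016NoBLE, App. D (D.17), (D.21) (pp. 1114–1115)] -/
def nobleMajPhiM3 (d : ℕ) (p : unitInterval) (i : BetaMap.Inputs) (ι : Fin d × Bool) (x : Site d) : ℝ :=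
  i.mu * i.mubOverMu * lconv (nobleXiCls d p fun N => N) (nobleMajW0Dir d p i ι) x

/-- **The majorant `m_Φ`** of `|R_Φ|`: `(Ξ^{(0)}_R + Ξ^{(1)}_R) + Ξ^{[≥2]} + Σ_ι (M₁ + M₂ + M₃)_ι + M₄`.
[cite: FitznerVanDerHofstad2016NoBLE, App. D Step 3 (D.15)–(D.21) (pp. 1113–1115)] -/
def nobleMajPhi (S : NobleSplit d p) (i : BetaMap.Inputs) (x : Site d) : ℝ :=
  (S.xiR 0 x + S.xiR 1 x) + nobleXiCls d p (fun N => N + 2) x +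
    ∑ ι : Fin d × Bool, (nobleMajPhiM1 S i ι x + nobleMajPhiM2 d p i ι x + nobleMajPhiM3 d p i ι x) +
      nobleMajPhiM4 d p i x

/-! ### The scalar constants -/

/-- Mass of `W₀`: `a₀ := 2d (1−μ²)⁻¹ (β_{Ξ^ι} + μ β_{Ξ^ι})`. [cite: FitznerVanDerHofstad2016NoBLE, App. D (D.17)–(D.18) (p. 1114)] -/
def nobleMajA0W (d : ℕ) (i : BetaMap.Inputs) : ℝ := 2 * d * ((1 - i.mu ^ 2)⁻¹ * (i.xiIotaAbs + i.mu * i.xiIotaAbs))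

/-- Displacement of `W₀`: `w₀ := 2d (1−μ²)⁻¹ (β_{ΔΞ^ι,ι} + μ β_{ΔΞ^ι,0})`. [cite: FitznerVanDerHofstad2016NoBLE, App. D (D.20)–(D.21) (p. 1115)] -/
def nobleMajW0W (d : ℕ) (i : BetaMap.Inputs) : ℝ :=
  2 * d * ((1 - i.mu ^ 2)⁻¹ * (i.xiIotaDeltaEi + i.mu * i.xiIotaDeltaZero))

/-- Mass of `τ₁`: `a₀ t/(1−t)` ((D.19) summed). [cite: FitznerVanDerHofstad2016NoBLE, App. D (D.19) (p. 1114)] -/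
def nobleMajA1 (d : ℕ) (i : BetaMap.Inputs) : ℝ := nobleMajA0W d i * (nobleMajT d i / (1 - nobleMajT d i))

/-- Displacement of `τ₁`: `W_B a₀/(1−t)² + w₀ t/(1−t)` ((D.20) summed). [cite: FitznerVanDerHofstad2016NoBLE, App. D (D.20) (p. 1115)] -/
def nobleMajW1 (d : ℕ) (i : BetaMap.Inputs) : ℝ :=
  nobleMajWB d i * nobleMajA0W d i * (1 / (1 - nobleMajT d i) ^ 2) + nobleMajW0W d i * (nobleMajT d i / (1 - nobleMajT d i))

/-- **The displacement constant `W_Φ` of the majorant**, as the bookkeeping produces it. [cite: FitznerVanDerHofstad2016NoBLE, App. D (D.21) (p. 1115)] -/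
def nobleMajPhiW (d : ℕ) (i : BetaMap.Inputs) : ℝ :=
  (i.xiR0Delta + i.xiR1Delta) + (i.xiEvenTailDelta + i.xiOddTailDelta) +
    2 * d * (i.mu * (1 - i.mu ^ 2)⁻¹ * (i.xiIotaRI0DeltaEi + i.mu * i.xiIotaRII0DeltaZero) +
      i.mu * (1 - i.mu ^ 2)⁻¹ *
        ((i.xiIotaOddDeltaEi + i.xiIotaEvenTailDeltaEi) + i.mu * (i.xiIotaOddDeltaZero + i.xiIotaEvenTailDeltaZero)) +
      i.mu * i.mubOverMu * (i.xiDeltaAbs * ((1 - i.mu ^ 2)⁻¹ * (i.xiIotaAbs + i.mu * i.xiIotaAbs)) +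
        i.xiAbs * ((1 - i.mu ^ 2)⁻¹ * (i.xiIotaDeltaEi + i.mu * i.xiIotaDeltaZero)))) +
    (i.mu * nobleMajW1 d i + i.mu * i.mubOverMu * (i.xiDeltaAbs * nobleMajA1 d i + i.xiAbs * nobleMajW1 d i))

variable (hsc : NobleScalarFacts d p i) (h43 : NobleAssumption43At d p S i)
include hsc h43

/-- `W₀,ι`: mass `(1−μ²)⁻¹(β_{Ξ^ι} + μβ_{Ξ^ι})`, displacement `(1−μ²)⁻¹(β_{ΔΞ^ι,ι} + μβ_{ΔΞ^ι,0})`. [cite: FitznerVanDerHofstad2016NoBLE, App. D (D.17)–(D.18), (D.20) (pp. 1114–1115)] -/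
theorem momentBound_nobleMajW0Dir (ι : Fin d × Bool) :
    MomentBound (nobleMajW0Dir d p i ι) ((1 - i.mu ^ 2)⁻¹ * (i.xiIotaAbs + i.mu * i.xiIotaAbs))
      ((1 - i.mu ^ 2)⁻¹ * (i.xiIotaDeltaEi + i.mu * i.xiIotaDeltaZero)) :=
  ((((momentBound_xiIotaCls_abs_shift h43 ι).add
      ((momentBound_xiIotaCls_abs h43 (srev ι)).const_mul hsc.imu_nonneg)).const_mul hsc.ci_nonneg)).congr
    fun _ => rfl

/-- `W₀`: mass `a₀`, displacement `w₀`. [cite: FitznerVanDerHofstad2016NoBLE, App. D (D.17)–(D.18) (p. 1114)] -/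
theorem momentBound_nobleMajW0 : MomentBound (nobleMajW0 d p i) (nobleMajA0W d i) (nobleMajW0W d i) :=
  (MomentBound.sum_dir fun ι => momentBound_nobleMajW0Dir hsc h43 ι).congr fun _ => rfl

/-- **`τ₁ = Σ_{n≥1} T_n`**: mass `A₁`, displacement `W₁`. [cite: FitznerVanDerHofstad2016NoBLE, App. D (D.18)–(D.20) (pp. 1114–1115)] -/
theorem momentBound_nobleMajTau1 (ht1 : nobleMajT d i < 1) :
    MomentBound (nobleMajTau1 d p i) (nobleMajA1 d i) (nobleMajW1 d i) :=
  (momentBound_titer_tail1 (momentBound_nobleMajB hsc h43) nobleMajB_neg (momentBound_nobleMajW0 hsc h43) ht1).congr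
    fun _ => rfl

/-- **`M₄`**: displacement `μW₁ + μβ_{μ̄/μ}(β_{ΔΞ} A₁ + β_Ξ W₁)` ((D.21) second line). [cite: FitznerVanDerHofstad2016NoBLE, App. D (D.19)–(D.21) (pp. 1114–1115)] -/
theorem momentBound_nobleMajPhiM4 (ht1 : nobleMajT d i < 1) :
    MomentBound (nobleMajPhiM4 d p i) (i.mu * nobleMajA1 d i + i.mu * i.mubOverMu * (i.xiAbs * nobleMajA1 d i))
      (i.mu * nobleMajW1 d i + i.mu * i.mubOverMu * (i.xiDeltaAbs * nobleMajA1 d i + i.xiAbs * nobleMajW1 d i)) := by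
  have hτ := momentBound_nobleMajTau1 hsc h43 ht1
  exact ((hτ.const_mul hsc.imu_nonneg).add
    (((momentBound_xiCls_abs h43).lconv (nobleXiCls_neg _) hτ).const_mul
      (mul_nonneg hsc.imu_nonneg hsc.q_nonneg))).congr fun _ => rfl

/-- `M₁,ι`: displacement `μ(1−μ²)⁻¹(β_{ΔΞ^ι_{R,I},ι} + μβ_{ΔΞ^ι_{R,II},0})`. [cite: FitznerVanDerHofstad2016NoBLE, Assumption 4.3 (4.46)–(4.47) (p. 1087); App. D (D.21) last line (p. 1115)] -/
theorem momentBound_nobleMajPhiM1 (ι : Fin d × Bool) : MomentBound (nobleMajPhiM1 S i ι)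
    (i.mu * (1 - i.mu ^ 2)⁻¹ * (i.xiIotaRI0 + i.mu * i.xiIotaRII0))
    (i.mu * (1 - i.mu ^ 2)⁻¹ * (i.xiIotaRI0DeltaEi + i.mu * i.xiIotaRII0DeltaZero)) :=
  ((((momentBound_of_SumLE_shift (S.xiIotaRI_nonneg ι) (h43.xiIotaRI0 ι) (𝐞 ι) (h43.xiIotaRI0DeltaEi ι)).add
      ((momentBound_of_SumLE (S.xiIotaRII_nonneg (srev ι)) (h43.xiIotaRII0 (srev ι))
        (h43.xiIotaRII0DeltaZero (srev ι))).const_mul hsc.imu_nonneg)).const_mul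
    (mul_nonneg hsc.imu_nonneg hsc.ci_nonneg))).congr fun _ => rfl

/-- `M₂,ι`: displacement `μ(1−μ²)⁻¹((β_{ΔΞ^ι,odd,ι} + β_{ΔΞ^ι,even≥2,ι}) + μ(β_{ΔΞ^ι,odd,0} + β_{ΔΞ^ι,even≥2,0}))`.
[cite: FitznerVanDerHofstad2016NoBLE, App. D (D.15), (D.21) last line (pp. 1113–1115)] -/
theorem momentBound_nobleMajPhiM2 (ι : Fin d × Bool) : MomentBound (nobleMajPhiM2 d p i ι)
    (i.mu * (1 - i.mu ^ 2)⁻¹ * ((i.xiIotaOdd + i.xiIotaEvenTail) + i.mu * (i.xiIotaOdd + i.xiIotaEvenTail)))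
    (i.mu * (1 - i.mu ^ 2)⁻¹ *
      ((i.xiIotaOddDeltaEi + i.xiIotaEvenTailDeltaEi) + i.mu * (i.xiIotaOddDeltaZero + i.xiIotaEvenTailDeltaZero))) :=
  ((((momentBound_xiIotaCls_tail1_shift h43 ι).add
      ((momentBound_xiIotaCls_tail1 h43 (srev ι)).const_mul hsc.imu_nonneg)).const_mul
    (mul_nonneg hsc.imu_nonneg hsc.ci_nonneg))).congr fun _ => rfl

/-- `M₃,ι`: displacement `μβ_{μ̄/μ}(β_{ΔΞ} L(W₀,ι) + β_Ξ W(W₀,ι))` ((D.21) third line). [cite: FitznerVanDerHofstad2016NoBLE, App. D (D.17), (D.21) third line (pp. 1114–1115)] -/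
theorem momentBound_nobleMajPhiM3 (ι : Fin d × Bool) : MomentBound (nobleMajPhiM3 d p i ι)
    (i.mu * i.mubOverMu * (i.xiAbs * ((1 - i.mu ^ 2)⁻¹ * (i.xiIotaAbs + i.mu * i.xiIotaAbs))))
    (i.mu * i.mubOverMu * (i.xiDeltaAbs * ((1 - i.mu ^ 2)⁻¹ * (i.xiIotaAbs + i.mu * i.xiIotaAbs)) +
      i.xiAbs * ((1 - i.mu ^ 2)⁻¹ * (i.xiIotaDeltaEi + i.mu * i.xiIotaDeltaZero)))) :=
  (((momentBound_xiCls_abs h43).lconv (nobleXiCls_neg _) (momentBound_nobleMajW0Dir hsc h43 ι)).const_mul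
    (mul_nonneg hsc.imu_nonneg hsc.q_nonneg)).congr fun _ => rfl

/-- **The majorant `m_Φ`** has displacement `≤ W_Φ`. [cite: FitznerVanDerHofstad2016NoBLE, App. D (D.21) (p. 1115)] -/
theorem momentBound_nobleMajPhi (ht1 : nobleMajT d i < 1) : ∃ L, MomentBound (nobleMajPhi S i) L (nobleMajPhiW d i) := by
  have hR : MomentBound (fun x => S.xiR 0 x + S.xiR 1 x) (i.xiR0 + i.xiR1) (i.xiR0Delta + i.xiR1Delta) :=
    (momentBound_of_SumLE (g := S.xiR 0) (fun x => S.xiR_nonneg zero_le_one x) h43.xiR0 h43.xiR0Delta).add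
      (momentBound_of_SumLE (g := S.xiR 1) (fun x => S.xiR_nonneg le_rfl x) h43.xiR1 h43.xiR1Delta)
  have hT := momentBound_xiCls_tail2 h43
  have hdir := MomentBound.sum_dir fun ι =>
    ((momentBound_nobleMajPhiM1 hsc h43 ι).add (momentBound_nobleMajPhiM2 hsc h43 ι)).add
      (momentBound_nobleMajPhiM3 hsc h43 ι)
  have h4 := momentBound_nobleMajPhiM4 hsc h43 ht1
  exact ⟨_, (((hR.add hT).add hdir).add h4).congr fun x => by simp only [nobleMajPhi]⟩

end Majorant

/-! ## Part D. Pointwise domination `|R_Φ| ≤ m_Φ` ([NoBLE17] App. D Step 3) -/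

section MajorantPointwise

local notation "𝐞" => Literature.Probability.Percolation.stepVec

variable {p : unitInterval} {P X : ℝ} {i : BetaMap.Inputs} {S : NobleSplit d p}

/-- Termwise absolute convergence of the Neumann series of `(𝟙 + A)⁻¹ w` at every point. [cite: FitznerVanDerHofstad2016NoBLE, App. D (D.18)–(D.19) (p. 1114)] -/
theorem summable_abs_kiter_nobleSW [NeZero d] (h : NobleL1At d p P X) (ι : Fin d × Bool) (x : Site d) :
    Summable fun n => |kiter (nobleKer d p) (nobleSeedW d p) n ι x| :=
  (kiter_series_l1 (summable_abs_nobleKer h) (summable_abs_nobleSeedW h) (nobleTheta_nonneg h)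
    (nobleTheta_lt_one h) (nobleKer_row_le h) (tsum_abs_nobleSeedW_le h) ι).1 x

/-- `T_ι ∈ ℓ¹`. [cite: FitznerVanDerHofstad2016NoBLE, App. D (D.18)–(D.19) (p. 1114)] -/
theorem summable_abs_nobleSWTail [NeZero d] (h : NobleL1At d p P X) (ι : Fin d × Bool) :
    Summable fun x => |nobleSWTail d p ι x| :=
  (kseries_tail_l1 (summable_abs_nobleKer h) (summable_abs_nobleSeedW h) (nobleTheta_nonneg h)
    (nobleTheta_lt_one h) (nobleKer_row_le h) (tsum_abs_nobleSeedW_le h) ι).1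

/-- `|T_ι(x)| ≤ Σ_n |(A^{n+1} w)_ι(x)|`. [cite: FitznerVanDerHofstad2016NoBLE, App. D (D.18)–(D.19) (p. 1114)] -/
theorem abs_nobleSWTail_le [NeZero d] (h : NobleL1At d p P X) (ι : Fin d × Bool) (x : Site d) :
    |nobleSWTail d p ι x| ≤ ∑' n, |kiter (nobleKer d p) (nobleSeedW d p) (n + 1) ι x| := by
  have h1 : Summable fun n => |kiter (nobleKer d p) (nobleSeedW d p) (n + 1) ι x| :=
    (summable_nat_add_iff (f := fun n => |kiter (nobleKer d p) (nobleSeedW d p) n ι x|) 1).2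
      (summable_abs_kiter_nobleSW h ι x)
  unfold nobleSWTail kseries
  simp only [← kiter_succ_eq_kiter_kapply]
  exact abs_tsum_negOnePow_mul_le h1

variable (hd : 2 ≤ d) (hp : p < criticalProbI d) (hsc : NobleScalarFacts d p i) (h43 : NobleAssumption43At d p S i)

include hsc h43 in
/-- `|w_ι(y)| ≤ W₀,ι(y)` ((D.17)). [cite: FitznerVanDerHofstad2016NoBLE, App. D (D.17) (p. 1114)] -/
theorem abs_nobleSeedW_le_majW0Dir (ι : Fin d × Bool) (y : Site d) : |nobleSeedW d p ι y| ≤ nobleMajW0Dir d p i ι y := by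
  have hc := hsc.c_nonneg
  have hμ0 := hsc.mu_nonneg
  have hY1 := nobleXiIotaCls_nonneg (p := p) (fun N => N) (𝐞 ι) (y + 𝐞 ι)
  have hY2 := nobleXiIotaCls_nonneg (p := p) (fun N => N) (𝐞 (srev ι)) y
  have h1 := abs_nobleXiIota_le h43 ι (y + 𝐞 ι)
  have h2 := abs_nobleXiIota_le h43 (srev ι) y
  calc |nobleSeedW d p ι y|
      ≤ (1 - nobleMu d p ^ 2)⁻¹ * (nobleXiIotaCls d p (fun N => N) (𝐞 ι) (y + 𝐞 ι) +
          nobleMu d p * nobleXiIotaCls d p (fun N => N) (𝐞 (srev ι)) y) := by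
        rw [nobleSeedW, abs_mul, abs_of_nonneg hc]
        refine mul_le_mul_of_nonneg_left ((abs_sub _ _).trans (add_le_add h1 ?_)) hc
        rw [abs_mul, abs_of_nonneg hμ0]
        exact mul_le_mul_of_nonneg_left h2 hμ0
    _ ≤ nobleMajW0Dir d p i ι y := by
        unfold nobleMajW0Dir
        exact mul_le_mul hsc.c_le (add_le_add le_rfl (mul_le_mul_of_nonneg_right hsc.mu_le hY2))
          (add_nonneg hY1 (mul_nonneg hμ0 hY2)) hsc.ci_nonneg

include hsc h43 in
/-- `Σ_ι |w_ι(y)| ≤ W₀(y)` ((D.17)–(D.18)). [cite: FitznerVanDerHofstad2016NoBLE, App. D (D.17)–(D.18) (p. 1114)] -/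
theorem sum_abs_nobleSeedW_le_majW0 (y : Site d) : ∑ ι, |nobleSeedW d p ι y| ≤ nobleMajW0 d p i y := by
  unfold nobleMajW0
  exact Finset.sum_le_sum fun ι _ => abs_nobleSeedW_le_majW0Dir hsc h43 ι y

include hsc h43 in
/-- The iterates `T_{n+1}` started at `W₀` are summable in `n` at each point. [folklore] -/
theorem summable_titer1_nobleMaj (ht1 : nobleMajT d i < 1) (x : Site d) :
    Summable fun n => titer (nobleMajB d p i) (nobleMajW0 d p i) (n + 1) x := by
  have hB := momentBound_nobleMajB hsc h43
  have h0 := momentBound_nobleMajW0 hsc h43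
  have hn := momentBound_titer hB nobleMajB_neg h0
  refine Summable.of_nonneg_of_le (fun n => (hn (n + 1)).nonneg x) (fun n => (hn (n + 1)).apply_le x) ?_
  exact (tsum_pow_add_one_mul hB.L_nonneg ht1 _).1

include hd hp hsc h43 in
/-- **`Σ_ι |T_ι(x)| ≤ τ₁(x)`** ((D.18)–(D.19)). [cite: FitznerVanDerHofstad2016NoBLE, App. D (D.17)–(D.19) (p. 1114)] -/
theorem sum_abs_nobleSWTail_le_majTau1 [NeZero d] (h : NobleL1At d p P X) (ht1 : nobleMajT d i < 1) (x : Site d) :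
    ∑ ι, |nobleSWTail d p ι x| ≤ nobleMajTau1 d p i x := by
  have hB := momentBound_nobleMajB hsc h43
  have h0 := momentBound_nobleMajW0 hsc h43
  have hn := momentBound_titer hB nobleMajB_neg h0
  have hb := momentBound_nobleMajBDir hsc h43
  have hι : ∀ ι, Summable fun n => |kiter (nobleKer d p) (nobleSeedW d p) (n + 1) ι x| := fun ι =>
    (summable_nat_add_iff (f := fun n => |kiter (nobleKer d p) (nobleSeedW d p) n ι x|) 1).2
      (summable_abs_kiter_nobleSW h ι x)
  have hk : ∀ n y, ∑ ι, |kiter (nobleKer d p) (nobleSeedW d p) n ι y| ≤ titer (nobleMajB d p i) (nobleMajW0 d p i) n y :=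
    sum_abs_kiter_le_titer (summable_abs_nobleKer h) (summable_abs_nobleSeedW h) (fun ι y => (hb ι).nonneg y)
      (fun ι => (hb ι).summable) (abs_nobleKer_le_majBDir hd hp hsc h43) (sum_abs_nobleSeedW_le_majW0 hsc h43)
      (fun n y => (hn n).nonneg y) fun n => (hn n).summable
  calc ∑ ι, |nobleSWTail d p ι x| ≤ ∑ ι, ∑' n, |kiter (nobleKer d p) (nobleSeedW d p) (n + 1) ι x| :=
        Finset.sum_le_sum fun ι _ => abs_nobleSWTail_le h ι x
    _ = ∑' n, ∑ ι, |kiter (nobleKer d p) (nobleSeedW d p) (n + 1) ι x| :=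
        (Summable.tsum_finsetSum fun ι _ => hι ι).symm
    _ ≤ nobleMajTau1 d p i x :=
        Summable.tsum_le_tsum (fun n => hk (n + 1) x) (summable_sum fun ι _ => hι ι)
          (summable_titer1_nobleMaj hsc h43 ht1 x)

include hd hp hsc h43 in
/-- **The `T`-terms**: `Σ_ι |μ_p (T_ι + Ψ^ι ⋆ T_ι)(x)| ≤ M₄(x)` ((D.19)–(D.21) second line). [cite: FitznerVanDerHofstad2016NoBLE, App. D (D.18)–(D.21) (pp. 1114–1115)] -/
theorem sum_abs_phiT4_le_majPhiM4 [NeZero d] (h : NobleL1At d p P X) (ht1 : nobleMajT d i < 1) (x : Site d) :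
    ∑ ι, |nobleMu d p * (nobleSWTail d p ι x + lconv (noblePsi d p ι) (nobleSWTail d p ι) x)| ≤
      nobleMajPhiM4 d p i x := by
  have hμ0 := hsc.mu_nonneg
  have hq0 := hsc.qp_nonneg
  have hτ := momentBound_nobleMajTau1 hsc h43 ht1
  have hXA := momentBound_xiCls_abs h43
  have hXq : Summable fun y => (p : ℝ) / nobleMu d p * nobleXiCls d p (fun N => N) y := hXA.summable.mul_left _
  have htail := sum_abs_nobleSWTail_le_majTau1 hd hp hsc h43 h ht1
  have hconv : ∀ ι, |lconv (noblePsi d p ι) (nobleSWTail d p ι) x| ≤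
      lconv (fun y => (p : ℝ) / nobleMu d p * nobleXiCls d p (fun N => N) y) (fun y => |nobleSWTail d p ι y|) x :=
    fun ι => abs_lconv_le_lconv (abs_noblePsi_le hd hp h43 ι) (fun y => le_rfl) hXq
      (summable_abs_nobleSWTail h ι) x
  have hsum : ∑ ι, lconv (fun y => (p : ℝ) / nobleMu d p * nobleXiCls d p (fun N => N) y)
        (fun y => |nobleSWTail d p ι y|) x =
      lconv (fun y => (p : ℝ) / nobleMu d p * nobleXiCls d p (fun N => N) y)
        (fun y => ∑ ι, |nobleSWTail d p ι y|) x :=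
    (lconv_finset_sum_right _ _ (fun ι y => |nobleSWTail d p ι y|) x fun ι _ =>
      summable_mul_shift_of_abs_le (f := fun y => (p : ℝ) / nobleMu d p * nobleXiCls d p (fun N => N) y)
        (g := fun y => |nobleSWTail d p ι y|) hXq.abs
        (abs_le_tsum_of_nonneg (fun _ => abs_nonneg _) (summable_abs_nobleSWTail h ι)) x).symm
  have hmono : lconv (fun y => (p : ℝ) / nobleMu d p * nobleXiCls d p (fun N => N) y)
        (fun y => ∑ ι, |nobleSWTail d p ι y|) x ≤
      (p : ℝ) / nobleMu d p * lconv (nobleXiCls d p fun N => N) (nobleMajTau1 d p i) x := by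
    rw [← lconv_const_mul_left]
    exact lconv_mono (fun y => mul_nonneg hq0 (nobleXiCls_nonneg _ y)) (fun y => le_rfl)
      (fun y => Finset.sum_nonneg fun ι _ => abs_nonneg _) htail hXq hτ.summable x
  have hL0 : 0 ≤ lconv (nobleXiCls d p fun N => N) (nobleMajTau1 d p i) x :=
    lconv_nonneg (nobleXiCls_nonneg _) hτ.nonneg x
  calc ∑ ι, |nobleMu d p * (nobleSWTail d p ι x + lconv (noblePsi d p ι) (nobleSWTail d p ι) x)|
      ≤ ∑ ι, nobleMu d p * (|nobleSWTail d p ι x| + lconv (fun y => (p : ℝ) / nobleMu d p * nobleXiCls d p (fun N => N) y)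
          (fun y => |nobleSWTail d p ι y|) x) := Finset.sum_le_sum fun ι _ => by
        rw [abs_mul, abs_of_nonneg hμ0]
        exact mul_le_mul_of_nonneg_left ((abs_add_le _ _).trans (add_le_add le_rfl (hconv ι))) hμ0
    _ = nobleMu d p * (∑ ι, |nobleSWTail d p ι x| + ∑ ι, lconv
          (fun y => (p : ℝ) / nobleMu d p * nobleXiCls d p (fun N => N) y) (fun y => |nobleSWTail d p ι y|) x) := by
        rw [← Finset.sum_add_distrib, Finset.mul_sum]
    _ ≤ nobleMu d p * (nobleMajTau1 d p i x +
          (p : ℝ) / nobleMu d p * lconv (nobleXiCls d p fun N => N) (nobleMajTau1 d p i) x) := by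
        rw [hsum]
        exact mul_le_mul_of_nonneg_left (add_le_add (htail x) hmono) hμ0
    _ ≤ nobleMajPhiM4 d p i x := by
        rw [nobleMajPhiM4, mul_add, ← mul_assoc]
        exact add_le_add (mul_le_mul_of_nonneg_right hsc.mu_le (hτ.nonneg x))
          (mul_le_mul_of_nonneg_right hsc.mu_qp_le hL0)

include hd hp hsc h43 in
/-- **Direction-`ι` remainder**: `|R_{Φ,ι}(x)| ≤ M₁,ι(x) + M₂,ι(x) + M₃,ι(x) + |μ_p (T_ι + Ψ^ι ⋆ T_ι)(x)|` ((D.16)–(D.21)).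
[cite: FitznerVanDerHofstad2016NoBLE, App. D Step 3 (D.15)–(D.21) (pp. 1113–1115)] -/
theorem abs_noblePhiDirRem_le (ι : Fin d × Bool) (x : Site d) :
    |noblePhiDirRem S ι x| ≤ nobleMajPhiM1 S i ι x + nobleMajPhiM2 d p i ι x + nobleMajPhiM3 d p i ι x +
      |nobleMu d p * (nobleSWTail d p ι x + lconv (noblePsi d p ι) (nobleSWTail d p ι) x)| := by
  have hμ0 := hsc.mu_nonneg
  have hc := hsc.c_nonneg
  have hXq : Summable fun y => (p : ℝ) / nobleMu d p * nobleXiCls d p (fun N => N) y :=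
    (momentBound_xiCls_abs h43).summable.mul_left _
  -- the `Ξ^ι_R`-piece
  have h1 : |nobleMu d p * (1 - nobleMu d p ^ 2)⁻¹ * (S.xiIotaRI ι (x + 𝐞 ι) - nobleMu d p * S.xiIotaRII (srev ι) x)| ≤
      nobleMajPhiM1 S i ι x := by
    have hY1 := S.xiIotaRI_nonneg ι (x + 𝐞 ι)
    have hY2 := S.xiIotaRII_nonneg (srev ι) x
    rw [abs_mul, abs_mul, abs_of_nonneg hμ0, abs_of_nonneg hc, nobleMajPhiM1]
    refine mul_le_mul hsc.mu_c_le ((abs_sub _ _).trans (add_le_add (le_of_eq (abs_of_nonneg hY1)) ?_))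
      (abs_nonneg _) (mul_nonneg hsc.imu_nonneg hsc.ci_nonneg)
    rw [abs_mul, abs_of_nonneg hμ0, abs_of_nonneg hY2]
    exact mul_le_mul_of_nonneg_right hsc.mu_le hY2
  -- the `Ξ^ι_{≥1}`-piece
  have h2 : |nobleMu d p * (1 - nobleMu d p ^ 2)⁻¹ *
      (nobleXiIotaTail d p ι (x + 𝐞 ι) - nobleMu d p * nobleXiIotaTail d p (srev ι) x)| ≤ nobleMajPhiM2 d p i ι x := by
    have hY2 := nobleXiIotaCls_nonneg (p := p) (fun N => N + 1) (𝐞 (srev ι)) x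
    have e1 := abs_nobleXiIotaTail_le h43 ι (x + 𝐞 ι)
    have e2 := abs_nobleXiIotaTail_le h43 (srev ι) x
    rw [abs_mul, abs_mul, abs_of_nonneg hμ0, abs_of_nonneg hc, nobleMajPhiM2]
    refine mul_le_mul hsc.mu_c_le ((abs_sub _ _).trans (add_le_add e1 ?_)) (abs_nonneg _)
      (mul_nonneg hsc.imu_nonneg hsc.ci_nonneg)
    rw [abs_mul, abs_of_nonneg hμ0]
    exact mul_le_mul hsc.mu_le e2 (abs_nonneg _) hsc.imu_nonneg
  -- the `Ψ^ι ⋆ w_ι`-piece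
  have h3 : |nobleMu d p * lconv (noblePsi d p ι) (nobleSeedW d p ι) x| ≤ nobleMajPhiM3 d p i ι x := by
    have hW := momentBound_nobleMajW0Dir hsc h43 ι
    have hcv : |lconv (noblePsi d p ι) (nobleSeedW d p ι) x| ≤
        lconv (fun y => (p : ℝ) / nobleMu d p * nobleXiCls d p (fun N => N) y) (nobleMajW0Dir d p i ι) x :=
      abs_lconv_le_lconv (abs_noblePsi_le hd hp h43 ι) (abs_nobleSeedW_le_majW0Dir hsc h43 ι) hXq hW.summable x
    have hL0 : 0 ≤ lconv (nobleXiCls d p fun N => N) (nobleMajW0Dir d p i ι) x :=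
      lconv_nonneg (nobleXiCls_nonneg _) hW.nonneg x
    rw [lconv_const_mul_left] at hcv
    rw [abs_mul, abs_of_nonneg hμ0, nobleMajPhiM3]
    calc nobleMu d p * |lconv (noblePsi d p ι) (nobleSeedW d p ι) x|
        ≤ nobleMu d p * ((p : ℝ) / nobleMu d p * lconv (nobleXiCls d p fun N => N) (nobleMajW0Dir d p i ι) x) :=
          mul_le_mul_of_nonneg_left hcv hμ0
      _ = nobleMu d p * ((p : ℝ) / nobleMu d p) * lconv (nobleXiCls d p fun N => N) (nobleMajW0Dir d p i ι) x := by
          ring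
      _ ≤ i.mu * i.mubOverMu * lconv (nobleXiCls d p fun N => N) (nobleMajW0Dir d p i ι) x :=
          mul_le_mul_of_nonneg_right hsc.mu_qp_le hL0
  unfold noblePhiDirRem
  refine (abs_add_le _ _).trans (add_le_add ((abs_sub _ _).trans (add_le_add ((abs_add_le _ _).trans
    (add_le_add ?_ h2)) h3)) le_rfl)
  rw [abs_neg]
  exact h1

include hd hp hsc h43 in
/-- **`|R_Φ(x)| ≤ m_Φ(x)`.** [cite: FitznerVanDerHofstad2016NoBLE, App. D Step 3 (D.15)–(D.21) (pp. 1113–1115)] -/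
theorem abs_noblePhiRem_le_majPhi [NeZero d] (h : NobleL1At d p P X) (ht1 : nobleMajT d i < 1) (x : Site d) :
    |noblePhiRem S x| ≤ nobleMajPhi S i x := by
  have hR : |S.xiR 0 x - S.xiR 1 x| ≤ S.xiR 0 x + S.xiR 1 x :=
    (abs_sub _ _).trans (le_of_eq (by
      rw [abs_of_nonneg (S.xiR_nonneg zero_le_one x), abs_of_nonneg (S.xiR_nonneg le_rfl x)]))
  have hT := abs_nobleXiTail_le h43 x
  have hdir := fun ι => abs_noblePhiDirRem_le hd hp hsc h43 ι x
  have h4 := sum_abs_phiT4_le_majPhiM4 hd hp hsc h43 h ht1 x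
  have hS : |∑ ι, noblePhiDirRem S ι x| ≤
      ∑ ι, (nobleMajPhiM1 S i ι x + nobleMajPhiM2 d p i ι x + nobleMajPhiM3 d p i ι x) + nobleMajPhiM4 d p i x := by
    refine (Finset.abs_sum_le_sum_abs _ _).trans ((Finset.sum_le_sum fun ι _ => hdir ι).trans ?_)
    rw [Finset.sum_add_distrib]
    exact add_le_add le_rfl h4
  have h01 : |S.xiR 0 x - S.xiR 1 x + nobleXiTail d p x| ≤ (S.xiR 0 x + S.xiR 1 x) + nobleXiCls d p (fun N => N + 2) x :=
    (abs_add_le _ _).trans (add_le_add hR hT)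
  unfold noblePhiRem nobleMajPhi
  refine (abs_add_le _ _).trans ?_
  linarith

end MajorantPointwise

/-! ## Part E. (D.21) proved, and the assembled extended form without the (D.21) hypothesis -/

section D21

local notation "𝐞" => Literature.Probability.Percolation.stepVec

variable {p : unitInterval} {i : BetaMap.Inputs} {S : NobleSplit d p}

/-- **The bookkeeping constant IS the printed (D.21).** [cite: FitznerVanDerHofstad2016NoBLE, App. D (D.19)–(D.21) (pp. 1114–1115)] -/
theorem nobleMajPhiW_eq (hsc : NobleScalarFacts d p i) (ht1 : nobleMajT d i < 1) :
    nobleMajPhiW d i = BetaMap.betaRpDeltaCorr d i.mu i.mubOverMu i.mub i.xiAbs i.xiDeltaAbs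
      (i.xiR0Delta + i.xiR1Delta) (i.xiOddTailDelta + i.xiEvenTailDelta) i.xiIotaAbs i.xiIotaDeltaEi i.xiIotaDeltaZero
      (i.xiIotaOddDeltaEi + i.xiIotaEvenTailDeltaEi) (i.xiIotaOddDeltaZero + i.xiIotaEvenTailDeltaZero)
      i.xiIotaRI0DeltaEi i.xiIotaRII0DeltaZero := by
  have hμ0 := hsc.imu_nonneg
  have h1 : 1 - i.mu ≠ 0 := (sub_pos.2 hsc.imu_lt_one).ne'
  have h2 : 1 + i.mu ≠ 0 := by positivity
  have h3 : 1 - i.mu ^ 2 ≠ 0 := hsc.one_sub_imu_sq_pos.ne'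
  have h1' : 0 < 1 - i.mu := sub_pos.2 hsc.imu_lt_one
  have ht' : 1 - i.mu - 2 * d * i.mub * i.xiIotaAbs ≠ 0 := by
    have ht := ht1
    unfold nobleMajT at ht
    rw [div_mul_eq_mul_div, div_lt_one h1'] at ht
    linarith
  have h4 : 1 - i.mu ^ 2 = (1 - i.mu) * (1 + i.mu) := by ring
  simp only [nobleMajPhiW, nobleMajW1, nobleMajA1, nobleMajA0W, nobleMajW0W, nobleMajWB, nobleMajT,
    BetaMap.betaRpDeltaCorr]
  rw [h4]
  field_simp
  ring

variable (hd : 2 ≤ d) (hp : p < criticalProbI d)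
include hd hp

/-- **[NoBLE17, App. D (D.21) — theorem].** Under Assumption 4.3 with well-formed constants `i` (at `0 < p < p_c`):
`Σ_x ‖x‖₂² |R_Φ(x)|` converges and is at most the PRINTED `β_{ΔR,Φ}(i)` (`BetaMap.betaRpDeltaCorr`, i.e.
`BetaMap.extraOfInputsCorr d i 3`). [cite: FitznerVanDerHofstad2016NoBLE, App. D Step 3 (D.15)–(D.21) (pp. 1113–1115)] -/
theorem noblePhiRem_weighted (hp0 : 0 < (p : ℝ)) (hWF : NobleInputsWF d i) (h43 : NobleAssumption43At d p S i) :
    (Summable fun x => normSq x * |noblePhiRem S x|) ∧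
      ∑' x, normSq x * |noblePhiRem S x| ≤ BetaMap.extraOfInputsCorr d i 3 := by
  haveI : NeZero d := ⟨by omega⟩
  have hsc := nobleScalarFacts_of hd hp hp0 hWF h43
  have ht1 : nobleMajT d i < 1 := hWF.1.tmp2_lt_one
  have h := nobleL1At_of_assumption43 hd hp hp0 h43
  obtain ⟨L, hm⟩ := momentBound_nobleMajPhi hsc h43 ht1
  have hdom : ∀ x, |noblePhiRem S x| ≤ nobleMajPhi S i x := abs_noblePhiRem_le_majPhi hd hp hsc h43 h ht1
  have hns : ∀ x : Site d, normSq x = euclidNorm x ^ 2 := fun x => by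
    rw [euclidNorm, Real.sq_sqrt (Finset.sum_nonneg fun i _ => sq_nonneg _)]; rfl
  have h0 : ∀ x, 0 ≤ normSq x * |noblePhiRem S x| := fun x => mul_nonneg (normSq_nonneg x) (abs_nonneg _)
  have hle : ∀ x, normSq x * |noblePhiRem S x| ≤ euclidNorm x ^ 2 * nobleMajPhi S i x := fun x => by
    rw [hns x]
    exact mul_le_mul_of_nonneg_left (hdom x) (sq_nonneg _)
  have hs : Summable fun x => normSq x * |noblePhiRem S x| := Summable.of_nonneg_of_le h0 hle hm.summableW
  refine ⟨hs, ?_⟩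
  rw [BetaMap.extraOfInputsCorr_three, ← nobleMajPhiW_eq hsc ht1]
  exact (hs.tsum_le_tsum hle hm.summableW).trans hm.tsumW_le

/-- **[NoBLE17, Prop. 4.5(ii) / App. D — extended form with (D.21) PROVED].** As
`nobleSimplifiedFormF3At_of_assumptions₅` but with the table `NobleBetaF3.ofFn (extraOfInputsCorr d i)` (printed
`β_{ΔR,Φ}`) and WITHOUT the hypothesis (D.21): the remaining named analytic hypotheses are (D.13) and (D.29).
[cite: FitznerVanDerHofstad2016NoBLE, Prop. 4.5 (p. 1088); App. D (D.2), (D.3) (p. 1111), (D.13) (p. 1113), (D.21) (p. 1115), (D.29) (p. 1116)] -/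
theorem nobleSimplifiedFormF3At_of_assumptions₆ (hp0 : 0 < (p : ℝ)) (hWF : NobleInputsWF d i)
    (hE : PercolationNobleEquationAt d p) (h41 : NobleAssumption41At d p S) (h43 : NobleAssumption43At d p S i)
    (hTRS : IsTRS (fun x => ∑ ι, S.xiIotaAI ι (x + 𝐞 ι)))
    (hI : ∀ N ≤ 1, IsTRS (fun x => ∑ ι, S.psiAI N ι (x + 𝐞 ι)))
    (hPi : IsTRS (fun x => ∑ ι, ∑ κ, S.piA ι κ (x + 𝐞 ι + 𝐞 κ)))
    (hN1 : 0 ≤ BetaMap.betaCPhiLow d i.mu i.xiAlphaOneMinusZeroAtZero i.xiIotaAlphaIAtEi)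
    (hN2 : i.xiAbs + i.xiIotaAbs < 1) (hN3 : (BetaMap.nobleBetaOfInputs d i).βΨ < 1)
    (hN4 : 0 ≤ (BetaMap.nobleBetaOfInputs d i).αFlow)
    (hcap : i.mu ≤ 7 / 10) (hcapP : i.piAlphaLower ≤ 1 / 8)
    (hD13 : ∑' x, |nobleFRem S x| ≤ BetaMap.extraOfInputs d i 2)
    (hD29 : (Summable fun x => normSq x * |nobleFRem S x|) ∧
      ∑' x, normSq x * |nobleFRem S x| ≤ BetaMap.extraOfInputs d i 4) :
    NobleSimplifiedFormF3At d p (BetaMap.nobleBetaOfInputsCorr d i)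
      (NobleBetaF3.ofFn (BetaMap.extraOfInputsCorr d i)) := by
  haveI : NeZero d := ⟨by omega⟩
  have hp1 : (p : ℝ) < 1 :=
    lt_of_lt_of_le (show (p : ℝ) < (criticalProbI d : ℝ) by exact_mod_cast hp) (criticalProbI d).2.2
  have hμ0 : 0 < nobleMu d p := nobleMu_pos (by omega) hp0 hp1
  have h := nobleL1At_of_assumption43 hd hp hp0 h43
  have hD21 := noblePhiRem_weighted hd hp hp0 hWF h43
  -- Lemma 3.1 inputs (module 1)
  set η : Fin d × Bool := (⟨0, by omega⟩, true) with hη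
  obtain ⟨hrow, hcol⟩ := noble_pi_rowcol hd hp h41 h43 η
  have hψ : ∀ ι, ∑' x, noblePsi d p ι x = ∑' x, noblePsi d p η x := fun ι => noble_tsum_psi_eq hd hp h41 h43 ι η
  have hξι : ∀ ι, ∑' x, nobleXiIota d p ι x = ∑' x, nobleXiIota d p η x :=
    fun ι => noble_tsum_xiIota_eq h41 h43 ι η
  have hψB := noble_psi_lower hd hp hp0 h41 h43 η
  have hπB := noble_pi_upper hd hp hp0 h43 η
  have hψ1 : -1 < ∑' x, noblePsi d p η x := by linarith
  have hΞ : (∑' x, |nobleXi d p x|) ≤ i.xiAbs :=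
    (alternating_of_NSumLE (fun N x => nobleXiN_nonneg p N x) h43.xiAbs).2.1
  have hsmall : (∑' x, |nobleXi d p x|) + i.xiIotaAbs < 1 := by linarith
  have hβμ : (p : ℝ) ≤ (BetaMap.nobleBetaOfInputsCorr d i).βμ * nobleMu d p := h43.mubOverMu
  -- App. D Steps 1–2 (modules 2, 3b)
  have hΞs : ∀ x, Summable fun N => nobleXiN d p N x :=
    (l1_of_NSumLE (fun N x => nobleXiN_nonneg p N x) h43.xiAbs).1
  have hΞι : ∀ ι x, Summable fun N => nobleXiIotaN d p (𝐞 ι) N x := fun ι =>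
    (l1_of_NSumLE (fun N x => nobleXiIotaN_nonneg p (𝐞 ι) N x) (h43.xiIotaAbs ι)).1
  have hrem : ∀ x, nobleRem (noblePhi d p) (noblePhiAlpha S 0) (2 * d * noblePhiAlpha S (𝐞 η)) x =
      noblePhiRem S x := nobleRem_noblePhi_eq h h41 hTRS hΞs hΞι η
  obtain ⟨hcL, hcU⟩ := noble_cPhi_bounds hWF h43
  have hαΦ := noble_alphaPhi_bound hWF h41 h43 hTRS η
  have hRΦ : ∑' x, |nobleRem (noblePhi d p) (noblePhiAlpha S 0) (2 * d * noblePhiAlpha S (𝐞 η)) x| ≤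
      (BetaMap.nobleBetaOfInputsCorr d i).βRΦ := by
    rw [tsum_congr fun x => congrArg abs (hrem x)]
    exact (noblePhiRem_l1 hd hp hp0 h43).2.trans (noblePhiRemBound_le hd hWF h43)
  have hαF : (BetaMap.nobleBetaOfInputsCorr d i).αFlow ≤ nobleAlphaF S := noble_alphaF_lower (by omega) hWF h43 hN4
  -- the NobleBetaF3 bounds: (D.2) lower, (D.3) upper, (D.21) proved; (D.13), (D.29) from the hypotheses
  have hcΦlow : (NobleBetaF3.ofFn (BetaMap.extraOfInputsCorr (d : ℝ) i)).cΦlow ≤ noblePhiAlpha S 0 := by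
    rw [NobleBetaF3.ofFn_cΦlow, BetaMap.extraOfInputsCorr_zero]
    exact noble_cPhi_lower hWF h43
  have hαFup : nobleAlphaF S ≤ (NobleBetaF3.ofFn (BetaMap.extraOfInputsCorr (d : ℝ) i)).αFup := by
    rw [NobleBetaF3.ofFn_αFup, BetaMap.extraOfInputsCorr_one]
    exact noble_alphaF_upper (by omega) hWF h43 hcap hcapP
  have hRF : ∑' x, |nobleRem (nobleF d p) (nobleCF S) (nobleAlphaF S) x| ≤
      (NobleBetaF3.ofFn (BetaMap.extraOfInputsCorr (d : ℝ) i)).βRF := by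
    rw [NobleBetaF3.ofFn_βRF, BetaMap.extraOfInputsCorr_two]
    exact hD13
  have hsΦ : Summable fun x =>
      normSq x * |nobleRem (noblePhi d p) (noblePhiAlpha S 0) (2 * d * noblePhiAlpha S (𝐞 η)) x| :=
    hD21.1.congr fun x => by rw [hrem x]
  have hΔΦ : ∑' x, normSq x * |nobleRem (noblePhi d p) (noblePhiAlpha S 0) (2 * d * noblePhiAlpha S (𝐞 η)) x| ≤
      (NobleBetaF3.ofFn (BetaMap.extraOfInputsCorr (d : ℝ) i)).βΔRΦ := by
    rw [NobleBetaF3.ofFn_βΔRΦ, tsum_congr fun x => by rw [hrem x]]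
    exact hD21.2
  have hsF : Summable fun x => normSq x * |nobleRem (nobleF d p) (nobleCF S) (nobleAlphaF S) x| := hD29.1
  have hΔF : ∑' x, normSq x * |nobleRem (nobleF d p) (nobleCF S) (nobleAlphaF S) x| ≤
      (NobleBetaF3.ofFn (BetaMap.extraOfInputsCorr (d : ℝ) i)).βΔRFabs := by
    rw [NobleBetaF3.ofFn_βΔRFabs, BetaMap.extraOfInputsCorr_four]
    exact hD29.2
  -- App. D Steps 3–5 (modules 3a, 3b, 3c): the majorant of `(R_F)₋` and Lemma 2.12
  have hsc := nobleScalarFacts_of hd hp hp0 hWF h43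
  have ht1 : nobleMajT d i < 1 := hWF.1.tmp2_lt_one
  obtain ⟨hm, hm0, hmw, hβ⟩ := nobleMaj_data hsc h43 ht1
  have hT : IsTRS (nobleFAlpha S) := isTRS_nobleFAlpha h41 hI hPi
  have hΔ : ∀ k ∈ cube d, -((BetaMap.nobleBetaOfInputsCorr d i).βΔ * (1 - Dhat d k)) ≤
      cosFT (nobleRem (nobleF d p) (nobleCF S) (nobleAlphaF S)) 0 -
        cosFT (nobleRem (nobleF d p) (nobleCF S) (nobleAlphaF S)) k := fun k _ =>
    nobleFRem_lower_of_majorant h hm hm0 hmw (isTRS_nobleMaj h41 hI hPi)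
      (neg_nobleMaj_le_nobleFRem hd hp hsc h43 h hT ht1) hβ k
  exact nobleSimplifiedFormF3At_of_bounds h hE hμ0 hψ hrow hcol hξι hψ1 hsmall _ _ hβμ (hN1.trans hcL) hcU hαΦ
    hαF hπB hψB hRΦ hΔ hcΦlow hαFup hRF hsΦ hΔΦ hsF hΔF

/-- **Percolation instance** of `nobleSimplifiedFormF3At_of_assumptions₆` (`S := percolationNobleSplit d p`): the
remaining inputs are the NoBLE equation, Assumption 4.3 with constants `i`, the decidable sign conditions and caps,
and the two named analytic hypotheses (D.13), (D.29).
[cite: FitznerVanDerHofstad2016NoBLE, Prop. 4.5 (p. 1088), App. D (pp. 1110–1117); FitznerVanDerHofstad2017, §3.5] -/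
theorem nobleSimplifiedFormF3At_percolation₆ (hp0 : 0 < (p : ℝ)) (hWF : NobleInputsWF d i)
    (hE : PercolationNobleEquationAt d p) (h43 : NobleAssumption43At d p (percolationNobleSplit d p hd hp) i)
    (hN1 : 0 ≤ BetaMap.betaCPhiLow d i.mu i.xiAlphaOneMinusZeroAtZero i.xiIotaAlphaIAtEi)
    (hN2 : i.xiAbs + i.xiIotaAbs < 1) (hN3 : (BetaMap.nobleBetaOfInputs d i).βΨ < 1)
    (hN4 : 0 ≤ (BetaMap.nobleBetaOfInputs d i).αFlow)
    (hcap : i.mu ≤ 7 / 10) (hcapP : i.piAlphaLower ≤ 1 / 8)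
    (hD13 : ∑' x, |nobleFRem (percolationNobleSplit d p hd hp) x| ≤ BetaMap.extraOfInputs d i 2)
    (hD29 : (Summable fun x => normSq x * |nobleFRem (percolationNobleSplit d p hd hp) x|) ∧
      ∑' x, normSq x * |nobleFRem (percolationNobleSplit d p hd hp) x| ≤ BetaMap.extraOfInputs d i 4) :
    NobleSimplifiedFormF3At d p (BetaMap.nobleBetaOfInputsCorr d i)
      (NobleBetaF3.ofFn (BetaMap.extraOfInputsCorr d i)) :=
  nobleSimplifiedFormF3At_of_assumptions₆ hd hp hp0 hWF hE (nobleAssumption41At_percolation hd p hp) h43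
    (percolationNobleSplit_xiIotaAI_shift_trs hd hp) (fun N _ => percolationNobleSplit_psiAI_shift_trs hd hp N)
    (percolationNobleSplit_piA_shift_trs hd hp) hN1 hN2 hN3 hN4 hcap hcapP hD13 hD29

end D21


end Literature.Probability.FitznerVanDerHofstad2017
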